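import Summits.BirchSwinnertonDyer.Rank1Residual.X10.MuTransferThreeOfFine
import Summits.BirchSwinnertonDyer.BirchSwinnertonDyer.Theorems.Rank1ResidualX9MuTransfer
import Literature.NumberTheory.EllipticCurves.Rank1Residual.PeriodUnitProofs
import Literature.NumberTheory.EllipticCurves.Wuthrich2014.RankOneEngineOddPrimeProofs
import Literature.NumberTheory.EllipticCurves.PadicSigmaThreeExistence
import HarnessLib

/-!
# Class X9 (`p ≥ 5` good ordinary, `E[p]` irreducible, `ρ̄_{E,p}` NOT surjective), PER PAIR: Kato's
# RATIONAL divisibility (Thm. 17.4 (2), no image hypothesis) + `μ = 0` at the pair (the cell's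
# `μ`-transfer, kernel-checked modulo Kato's zeta-element package F1) give the INTEGRAL divisibility —
# hence the Euler-system half `ord_p #Ш ≤ ord_p #Ш_an` in BOTH analytic ranks, Miller's `BSD(E,p)` at
# every X9 pair with `p ∤ #Ш(E/ℚ)_an`, and there the INTEGRAL main conjecture `char_Λ X = (L_p)` —
# Burungale–Castella–Skinner-FREE (print cell `bsd-print-x9`, seat p3; theorems only, nothing booked)

Seat p3 of the D-0131 (2) print cell `bsd-print-x9`; strategy «Kato's divisibility WITHOUT the
SL₂-image hypothesis (Kato 2004 Thm 12.5 / 17.4 (2), divisibility in `Λ[1/p]`) + certified analytic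
`(μ, λ)` per pair ⇒ integral equality where descent data force `λ_alg = λ_an` (rank-0 unit cells
first)». On class X9 (`Rank1Residual.ClassX9` of `Theorems/Rank1ResidualX9Defs`: non-CM, `p ≥ 5` good
ordinary, `E[p]` irreducible, `ρ̄_{E,p}` not surjective; so `p ∈ {5,7}`) NO printed theorem gives an
INTEGRAL divisibility `char_Λ X(E/ℚ_∞) ∣ L_p(E)`: Kato Thm. 17.4 (3) needs (12.5.2), BCS 2025 Thm.
1.1.2 (b) needs (im) — both false on X9 (`not_bcsHypothesisIm_of_classX9`,
`ClassX9.not_imageContainsSL2`). Printed for EVERY image is Kato's clause (2): `X` torsion and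
`p^n · L_p(f, α) ∈ ι(char_Λ X)` (tree fact `kato_divisibility`, clause 2); the `p`-power is the
`μ`-defect. Greenberg's `μ(X(E/ℚ_∞)) = 0` AT THE PAIR (binder `hμ` of §1) removes it — and on X9 the
cell `bsd-smallim` supplies `hμ` from ONE unit coefficient of `L_p(f, α)` (the `μ`-transfer,
`Rank1Residual.KatoMuTransfer`, item 19629), kernel-checked modulo the published construction fact
F1 = `Kato2004.exists_divisibilityInputs_fineQuotient_zeta` (aside 19843), from which Kato's Thm. 17.4
itself also follows (`X10.kato_divisibility_of_fine`). The generic odd-`p` engines are the X10 lane's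
(`X10.divisibility_of_kato_of_mu_eq_zero`, `X10.missingUpperBoundAt_of_kato_of_greenbergMu`,
`X10.mainConjecture_iff_bsdp_of_kato_of_greenbergMu`) and Wuthrich's rank-one cofactor engine
`exists_cofactor_of_mem_charIdeal_of_rank_one_odd`; the Mazur–Tate `σ` is the tree theorem
`mazur_tate_sigma_exists_odd_holds`, the period unit `ord_p(Ω⁺_f/Ω_E) = 0` is
`padicValRat_periodRatio_eq_zero_of_five_le` (fact `realPeriodRat_eq_unit_mul_plusPeriod`, `h5`).

§1 (`hμ`-form, X9 pair, `hK` = Kato 17.4 at the pair): the integral divisibility datum; the upper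
half at `r_an = 0`; the upper half at `r_an = 1` modulo the Schneider certificate (NEW at `p ≥ 5`:
the X9 twin of `X10.missingUpperBoundAt_three_rankOne_of_divisibility`); `BSD(E,p)` in both ranks at a
`p ∤ #Ш_an` pair; `MazurMainConjecture W p ↔ BSDp W p` at `r_an = 0` and the integral main conjecture
at a rank-0 `p ∤ #Ш_an` pair. §2 suppliers of `hμ` / `hK`: the node `KatoMuTransfer` + one unit
coefficient; F1 + one unit coefficient (`X10.mu_eq_zero_of_fine`, UNCONDITIONAL kernel core at an odd
prime with irreducible non-surjective image); F1 ⇒ `hK`. §3 headline corollaries: node form and F1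
form of "`p ∤ #Ш_an` ⇒ `BSD(E,p)`" (both ranks) and of the integral main conjecture at the pair.

Binders of the F1 form: F1 (`hfine`); PUBLISHED Greenberg LNM 1716 Thm. 4.1 (`hGr`), Perrin-Riou–
Schneider (`hS`) / Perrin-Riou 1987 (`hPR`) at odd `p` (rank 1 only), modularity (`hmodP`, `hmodL`),
GZK (`hGZK`), the period unit (`h5`); FINITE per-pair certificates `hcertA` (one unit coefficient of
`L_p(f, α)`, exact modular symbols), `hunit` (`p ∤ #Ш(E/ℚ)_an`), `hSch` (rank 1). NO Burungale–
Castella–Skinner fact (no `BCS25-IMC-equiv@…` flag), no rational main conjecture, no Heegner-index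
computation, no image hypothesis beyond X9's `¬ Surj`. Currency: PER PAIR. The class-wide leaf
`BSDpOnClassX9` still needs the class-wide analytic `μ = 0` (item 19630 = Greenberg Conj. 1.11 on its
analytic side) and, on the `p ∣ #Ш_an` pairs, a lower half (`X9/IwasawaLowerBound`, BCS (a)) — NOT
claimed here. Beyond print: "irreducible non-surjective good ordinary `p ≥ 5`, `μ_an = 0`, `p ∤ #Ш_an`
⇒ BSD_p" is not a printed theorem (Kato 17.4 (3) / BCS (b) / Cha 2005 need (12.5.2) / (im) / a
Heegner-index computation); it is kernel-checked here modulo the published input F1.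

References: [Kato2004Asterisque] Thm. 12.5, 12.6 (p. 222), Thm. 17.4 (2) (p. 273), §17.13;
[GreenbergLNM1716] Conj. 1.11, Thm. 4.1; [GreenbergVatsal2000] (1)–(2), Prop. 3.7, Rem. 3.4;
[PerrinRiou1987] §1.4 Cor. 1.8; [BalakrishnanMullerStein2015] Thm. 1.7; [MazurSteinTate2006] Thm.
1.3; [Miller2011LMS] Def. 1.1; cell `bsd-smallim` KOLY-MEMO §5.7 (route SmallImageMuTransfer).
-/

set_option linter.dupNamespace false
set_option autoImplicit false

noncomputable section

open scoped Classical MatrixGroups ModularForm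

open CongruenceSubgroup WeierstrassCurve Literature.NumberTheory.EllipticCurves
  Literature.NumberTheory.EllipticCurves.ModularForms Literature.NumberTheory.EllipticCurves.Rank1Residual
  Literature.NumberTheory.EllipticCurves.Rank1Residual.Typed
  Literature.NumberTheory.EllipticCurves.Wuthrich2014
  Literature.NumberTheory.EllipticCurves.Kato2004
  Summit.BirchSwinnertonDyer.BirchSwinnertonDyer.Theorems.Rank1ResidualX1Defs

namespace Summit.BirchSwinnertonDyer.BirchSwinnertonDyer.Rank1Residual

variable (W : WeierstrassCurve ℚ) [W.IsElliptic] [W.IsGloballyMinimal] (p : ℕ) [Fact p.Prime]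

/-! ### §1. X9 pair, Greenberg's `μ = 0` at the pair (`hμ`) and Kato Thm. 17.4 (2) at the pair (`hK`) -/

/-- **X9, per pair, ANY rank: Kato Thm. 17.4 (2) + `μ(X(E/ℚ_∞)) = 0` ⟹ the Néron-normalised INTEGRAL
divisibility datum** — for every cyclotomic `(κ, γ)`, newform `f` of `W` at level `N_E`, period ratio
`ϖ` (`ϖ · Ω_E = Ω⁺_f`) and dual datum `D`: `X` is `Λ`-torsion and some `g ∈ char_Λ X` has
`ι g = ϖ · L_p(f, α)`. The X10 lane's `X10.divisibility_of_kato_of_mu_eq_zero` (the prime `p` of the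
UFD `Λ` divides the cofactor `n` times) with `ord_p ϖ = 0` from the period unit `h5` (`p ≥ 5`, `E[p]`
irreducible). Only clause (2) of `hK` is used (clause (3)'s antecedent is dead on X9).
[cite: Kato2004Asterisque, Thm. 17.4 (2) (p. 273)] [cite: GreenbergVatsal2000, p. 2 (1)–(2), Prop. (3.7) and §3 Remark (3.4)] -/
theorem X9.divisibility_of_kato_of_mu_eq_zero (h5 : realPeriodRat_eq_unit_mul_plusPeriod)
    (hK : ∀ (κ : ZpExtension ℚ p) (γ : Field.absoluteGaloisGroup ℚ) [NeZero (W.conductorNorm ℤ)]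
      (f : CuspForm (Gamma0 (W.conductorNorm ℤ)) 2), kato_divisibility W p (κ := κ) (γ := γ) (f := f))
    (hX9 : ClassX9 W p)
    (hμ : ∀ (κ : ZpExtension ℚ p) (γ : Field.absoluteGaloisGroup ℚ),
        κ.IsCyclotomic → κ.IsTopGenerator γ → IsCyclotomicVariable p γ →
      ∀ (D : W.SelmerDualData κ γ), D.mu = 0) :
    ∀ (κ : ZpExtension ℚ p) (γ : Field.absoluteGaloisGroup ℚ),
        κ.IsCyclotomic → κ.IsTopGenerator γ → IsCyclotomicVariable p γ →
      ∀ [NeZero (W.conductorNorm ℤ)] (f : CuspForm (Gamma0 (W.conductorNorm ℤ)) 2),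
        IsNewformOf W f → ∀ (ϖ : ℚ), (ϖ : ℝ) * W.realPeriodRat = plusPeriod f →
      ∀ (D : W.SelmerDualData κ γ), D.IsTorsion ∧
        ∃ g ∈ D.charIdeal, iwasawaToPowerSeries p g =
          PowerSeries.C (ϖ : ℚ_[p]) * padicLFunction f (unitRoot W p : ℚ_[p]) := by
  intro κ γ hκ hγ hγ' _ f hf ϖ hϖeq D
  obtain ⟨-, hp, hgood, hord, hirr, -⟩ := id hX9
  have hplus : plusPeriod f ≠ 0 := (IsNewform0.plusPeriod_pos_holds hf.1 hf.coeffField_eq_bot).ne'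
  have hϖ0 : ϖ ≠ 0 := by
    rintro rfl
    apply hplus
    rw [← hϖeq]
    simp
  exact Summit.BirchSwinnertonDyer.Rank1Residual.X10.divisibility_of_kato_of_mu_eq_zero W p (hK κ γ f)
    (by omega) hgood hord hirr hκ hγ hγ' hf D (hμ κ γ hκ hγ hγ' D) ϖ hϖ0
    (padicValRat_periodRatio_eq_zero_of_five_le h5 W p hp hgood hirr f hf ϖ hϖeq)

/-- **X9 ∩ {r_an = 0}, per pair: Kato 17.4 (2) + `μ = 0` at the pair ⟹ the Euler-system half
`ord_p #Ш(E/ℚ) ≤ ord_p #Ш(E/ℚ)_an`** (`Typed.MissingUpperBoundAt W p`) — the X10 lane's generic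
`μ`-zero road `X10.missingUpperBoundAt_of_kato_of_greenbergMu` read on X9, the period unit supplied by
`h5`. PUBLISHED binders `hK`, `hGr`, `hmodP`, `hGZK`, `h5`; `hL : L(E,1) ≠ 0`; hypothesis `hμ`.
[cite: Kato2004Asterisque, Thm. 17.4 (2) (p. 273)] [cite: GreenbergLNM1716, §1 Conj. 1.11 and Thm. 4.1 (p. 102)]
[cite: Miller2011LMS, Def. 1.1 (arXiv:1010.2431 p. 3)] -/
theorem X9.missingUpperBoundAt_rankZero_of_kato_of_mu_eq_zero (hGr : greenberg_charValue_rankZero)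
    (hmodP : nonempty_modularParametrizationData) (hGZK : rank_eq_analyticRank_of_analyticRank_le_one)
    (h5 : realPeriodRat_eq_unit_mul_plusPeriod)
    (hK : ∀ (κ : ZpExtension ℚ p) (γ : Field.absoluteGaloisGroup ℚ) [NeZero (W.conductorNorm ℤ)]
      (f : CuspForm (Gamma0 (W.conductorNorm ℤ)) 2), kato_divisibility W p (κ := κ) (γ := γ) (f := f))
    (hX9 : ClassX9 W p) (hL : W.entireLFunction 1 ≠ 0)
    (hμ : ∀ (κ : ZpExtension ℚ p) (γ : Field.absoluteGaloisGroup ℚ),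
        κ.IsCyclotomic → κ.IsTopGenerator γ → IsCyclotomicVariable p γ →
      ∀ (D : W.SelmerDualData κ γ), D.mu = 0) :
    Typed.MissingUpperBoundAt W p := by
  obtain ⟨-, hp, hgood, hord, hirr, -⟩ := id hX9
  exact Summit.BirchSwinnertonDyer.Rank1Residual.X10.missingUpperBoundAt_of_kato_of_greenbergMu W p hGr
    hmodP hGZK hK (by omega) hgood hord hirr hL
    (fun f hf ϖ hϖ ↦ padicValRat_periodRatio_eq_zero_of_five_le h5 W p hp hgood hirr f hf ϖ hϖ) hμ

/-- **X9 ∩ {r_an = 1}, per pair: Kato 17.4 (2) + `μ = 0` at the pair ⟹ the Euler-system half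
`ord_p #Ш(E/ℚ) ≤ ord_p #Ш(E/ℚ)_an`, modulo the Schneider certificate** `hSch` (non-degeneracy of THE
canonical cyclotomic `p`-adic height, ⟺ `[T¹]L_p ≠ 0`; rider C3 of route SmallImageMuTransfer). The §1
datum is fed to Wuthrich's cofactor engine `exists_cofactor_of_mem_charIdeal_of_rank_one_odd`:
`ord_p #Ш_an = ord_p h(0) + ord_p #Ш` with `h(0) ∈ ℤ_p ∖ {0}`. PUBLISHED binders `hK`,
Perrin-Riou–Schneider at odd `p` (`hS`, BMS 2016 Thm. 1.7), Perrin-Riou 1987 §1.4 (`hPR`), `hmodP`,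
`hGZK`, `h5`; the canonical height exists by `mazur_tate_sigma_exists_odd_holds` (tree theorem). The
X9 twin of `X10.missingUpperBoundAt_three_rankOne_of_divisibility` (X10 lane GEN 6).
[cite: Kato2004Asterisque, Thm. 17.4 (2) (p. 273)] [cite: PerrinRiou1987, §1.4 Cor. 1.8]
[cite: BalakrishnanMullerStein2015, Thm. 1.7] [cite: MazurSteinTate2006, Thm. 1.3]
[cite: Miller2011LMS, Def. 1.1 (arXiv:1010.2431 p. 3)] -/
theorem X9.missingUpperBoundAt_rankOne_of_kato_of_mu_eq_zero
    (hS : Schneider1985_order_charGenerator_odd) (hPR : perrinRiou_rankOne_leadingTerms_odd)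
    (hmodP : nonempty_modularParametrizationData) (hGZK : rank_eq_analyticRank_of_analyticRank_le_one)
    (h5 : realPeriodRat_eq_unit_mul_plusPeriod)
    (hK : ∀ (κ : ZpExtension ℚ p) (γ : Field.absoluteGaloisGroup ℚ) [NeZero (W.conductorNorm ℤ)]
      (f : CuspForm (Gamma0 (W.conductorNorm ℤ)) 2), kato_divisibility W p (κ := κ) (γ := γ) (f := f))
    (hX9 : ClassX9 W p) (hr1 : W.analyticRank = 1)
    (hSch : ∀ Dh : PAdicHeightData W p, Dh.IsCanonical → SchneiderConjecture Dh)
    (hμ : ∀ (κ : ZpExtension ℚ p) (γ : Field.absoluteGaloisGroup ℚ),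
        κ.IsCyclotomic → κ.IsTopGenerator γ → IsCyclotomicVariable p γ →
      ∀ (D : W.SelmerDualData κ γ), D.mu = 0) :
    Typed.MissingUpperBoundAt W p := by
  obtain ⟨-, hp, hgood, hord, hirr, -⟩ := id hX9
  have hp2 : p ≠ 2 := by omega
  have hdiv := X9.divisibility_of_kato_of_mu_eq_zero W p h5 hK hX9 hμ
  obtain ⟨κ, hκ, γ, hγ, hγ'⟩ := exists_isCyclotomic_isTopGenerator_isCyclotomicVariable_holds p
  obtain ⟨D⟩ := W.nonempty_selmerDualData_holds κ γ hγ
  haveI : NeZero (W.conductorNorm ℤ) := ⟨(W.conductorNorm_pos_holds).ne'⟩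
  obtain ⟨Dm⟩ := hmodP W
  obtain ⟨ϖ, -, hϖ, -⟩ := Dm.exists_rat_mul_realPeriodRat_eq_plusPeriod
  obtain ⟨Dh, hDh, -⟩ :=
    existsUnique_isCanonical_of_odd mazur_tate_sigma_exists_odd_holds W p hp2 hgood hord
  obtain ⟨hXt, g, hgmem, hιg⟩ := hdiv κ γ hκ hγ hγ' Dm.f Dm.isNewformOf ϖ hϖ D
  obtain ⟨fE, h, s, -, -, -, -, hsha, -, hval⟩ := exists_cofactor_of_mem_charIdeal_of_rank_one_odd
    hS hPR hGZK W p hp2 hgood hord hr1 hκ hγ hγ' Dm.isNewformOf ϖ hϖ Dh hDh (hSch Dh hDh) D hXt g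
    hgmem hιg
  refine ⟨s, hsha, ?_⟩
  have h0 : 0 ≤ (((PowerSeries.constantCoeff h : ℤ_[p]) : ℚ_[p])).valuation :=
    PadicInt.valuation_coe_nonneg
  rw [hval]
  linarith

/-- **X9 (analytic rank `≤ 1`), per pair, at a pair with `ord_p #Ш(E/ℚ)_an = 0`: Kato 17.4 (2) + `μ = 0`
at the pair + the finite certificates ⟹ Miller's `BSD(E,p)`.** The lower half `ord_p #Ш_an ≤ ord_p #Ш`
is VACUOUS when the analytic order of `Ш` is a `p`-adic unit (`hunit`, exact census datum); the upper
half is the rank-0 / rank-1 theorem above (`hS`, `hPR`, `hSch` idle at rank 0); GZK assembles `BSDp W p`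
(`Typed.bsdp_of_missingPPartAt`). No Burungale–Castella–Skinner fact, no rational main conjecture.
[cite: Kato2004Asterisque, Thm. 17.4 (2) (p. 273)] [cite: GreenbergLNM1716, §1 Conj. 1.11 and Thm. 4.1 (p. 102)]
[cite: PerrinRiou1987, §1.4 Cor. 1.8] [cite: Miller2011LMS, Def. 1.1 (arXiv:1010.2431 p. 3)] -/
theorem X9.bsdp_of_kato_of_mu_eq_zero_of_shaAn_unit (hGr : greenberg_charValue_rankZero)
    (hS : Schneider1985_order_charGenerator_odd) (hPR : perrinRiou_rankOne_leadingTerms_odd)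
    (hmodP : nonempty_modularParametrizationData) (hmodL : hasEntireLFunction_rat)
    (hGZK : rank_eq_analyticRank_of_analyticRank_le_one) (h5 : realPeriodRat_eq_unit_mul_plusPeriod)
    (hK : ∀ (κ : ZpExtension ℚ p) (γ : Field.absoluteGaloisGroup ℚ) [NeZero (W.conductorNorm ℤ)]
      (f : CuspForm (Gamma0 (W.conductorNorm ℤ)) 2), kato_divisibility W p (κ := κ) (γ := γ) (f := f))
    (hX9 : ClassX9 W p) (hr : W.analyticRank ≤ 1)
    (hSch : W.analyticRank = 1 → ∀ Dh : PAdicHeightData W p, Dh.IsCanonical → SchneiderConjecture Dh)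
    (hμ : ∀ (κ : ZpExtension ℚ p) (γ : Field.absoluteGaloisGroup ℚ),
        κ.IsCyclotomic → κ.IsTopGenerator γ → IsCyclotomicVariable p γ →
      ∀ (D : W.SelmerDualData κ γ), D.mu = 0)
    (hunit : ∃ q : ℚ, shaAn W = (q : ℂ) ∧ padicValRat p q = 0) : BSDp W p := by
  have hlow : Typed.MissingLowerBoundAt W p := by
    obtain ⟨q, hq, hv⟩ := hunit
    exact ⟨q, hq, by rw [hv]; exact_mod_cast Nat.zero_le _⟩
  refine Typed.bsdp_of_missingPPartAt W p hGZK hr (Typed.missingPPartAt_of_lower_of_upper W p hlow ?_)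
  rcases Nat.le_one_iff_eq_zero_or_eq_one.mp hr with hr0 | hr1
  · have hL : W.entireLFunction 1 ≠ 0 := (W.analyticRank_eq_zero_iff_holds (hmodL W)).1 hr0
    exact X9.missingUpperBoundAt_rankZero_of_kato_of_mu_eq_zero W p hGr hmodP hGZK h5 hK hX9 hL hμ
  · exact X9.missingUpperBoundAt_rankOne_of_kato_of_mu_eq_zero W p hS hPR hmodP hGZK h5 hK hX9 hr1
      (hSch hr1) hμ

/-- **X9 ∩ {r_an = 0}, per pair: under Kato 17.4 (2) + `μ = 0` at the pair, Mazur's INTEGRAL cyclotomic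
main conjecture at the pair (`MazurMainConjecture W p`, Néron normalisation, every datum) ⟺ Miller's
`BSD(E,p)`** (`X10.mainConjecture_iff_bsdp_of_kato_of_greenbergMu` on X9, `h5` for the period unit).
[cite: Kato2004Asterisque, Thm. 17.4 (2) (p. 273)] [cite: GreenbergLNM1716, §1 Conj. 1.11, Thm. 4.1 and §5]
[cite: Miller2011LMS, Def. 1.1 (arXiv:1010.2431 p. 3)] -/
theorem X9.mazurMainConjecture_iff_bsdp_rankZero_of_kato_of_mu_eq_zero
    (hGr : greenberg_charValue_rankZero) (hmodP : nonempty_modularParametrizationData)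
    (hGZK : rank_eq_analyticRank_of_analyticRank_le_one) (h5 : realPeriodRat_eq_unit_mul_plusPeriod)
    (hK : ∀ (κ : ZpExtension ℚ p) (γ : Field.absoluteGaloisGroup ℚ) [NeZero (W.conductorNorm ℤ)]
      (f : CuspForm (Gamma0 (W.conductorNorm ℤ)) 2), kato_divisibility W p (κ := κ) (γ := γ) (f := f))
    (hX9 : ClassX9 W p) (hL : W.entireLFunction 1 ≠ 0)
    (hμ : ∀ (κ : ZpExtension ℚ p) (γ : Field.absoluteGaloisGroup ℚ),
        κ.IsCyclotomic → κ.IsTopGenerator γ → IsCyclotomicVariable p γ →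
      ∀ (D : W.SelmerDualData κ γ), D.mu = 0) :
    MazurMainConjecture W p ↔ BSDp W p := by
  obtain ⟨-, hp, hgood, hord, hirr, -⟩ := id hX9
  exact Summit.BirchSwinnertonDyer.Rank1Residual.X10.mainConjecture_iff_bsdp_of_kato_of_greenbergMu W p
    hGr hmodP hGZK hK (by omega) hgood hord hirr hL
    (fun f hf ϖ hϖ ↦ padicValRat_periodRatio_eq_zero_of_five_le h5 W p hp hgood hirr f hf ϖ hϖ) hμ

/-- **X9 ∩ {r_an = 0}, per pair, at a pair with `ord_p #Ш(E/ℚ)_an = 0`: Kato 17.4 (2) + `μ = 0` at the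
pair ⟹ Mazur's INTEGRAL cyclotomic main conjecture at the pair** — the integral EQUALITY
`char_Λ X(E/ℚ_∞) = (ϖ · L_p(f, α))` for every datum (the typed missing input
`IntegralMainConjectureOnClassX9` INHABITED at the pair): Kato's one-sided rational divisibility made
two-sided and integral by `μ = 0` plus the trivial lower bound.
[cite: Kato2004Asterisque, Thm. 17.4 (2) (p. 273)] [cite: GreenbergLNM1716, §1 Conj. 1.11, Thm. 4.1 and §5] -/
theorem X9.mazurMainConjecture_rankZero_of_kato_of_mu_eq_zero_of_shaAn_unit
    (hGr : greenberg_charValue_rankZero) (hmodP : nonempty_modularParametrizationData)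
    (hmodL : hasEntireLFunction_rat) (hGZK : rank_eq_analyticRank_of_analyticRank_le_one)
    (h5 : realPeriodRat_eq_unit_mul_plusPeriod)
    (hK : ∀ (κ : ZpExtension ℚ p) (γ : Field.absoluteGaloisGroup ℚ) [NeZero (W.conductorNorm ℤ)]
      (f : CuspForm (Gamma0 (W.conductorNorm ℤ)) 2), kato_divisibility W p (κ := κ) (γ := γ) (f := f))
    (hX9 : ClassX9 W p) (hr0 : W.analyticRank = 0)
    (hμ : ∀ (κ : ZpExtension ℚ p) (γ : Field.absoluteGaloisGroup ℚ),
        κ.IsCyclotomic → κ.IsTopGenerator γ → IsCyclotomicVariable p γ →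
      ∀ (D : W.SelmerDualData κ γ), D.mu = 0)
    (hunit : ∃ q : ℚ, shaAn W = (q : ℂ) ∧ padicValRat p q = 0) : MazurMainConjecture W p := by
  have hL : W.entireLFunction 1 ≠ 0 := (W.analyticRank_eq_zero_iff_holds (hmodL W)).1 hr0
  have hlow : Typed.MissingLowerBoundAt W p := by
    obtain ⟨q, hq, hv⟩ := hunit
    exact ⟨q, hq, by rw [hv]; exact_mod_cast Nat.zero_le _⟩
  have hbsdp : BSDp W p := Typed.bsdp_of_missingPPartAt W p hGZK (by rw [hr0]; exact Nat.zero_le _)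
    (Typed.missingPPartAt_of_lower_of_upper W p hlow
      (X9.missingUpperBoundAt_rankZero_of_kato_of_mu_eq_zero W p hGr hmodP hGZK h5 hK hX9 hL hμ))
  exact (X9.mazurMainConjecture_iff_bsdp_rankZero_of_kato_of_mu_eq_zero W p hGr hmodP hGZK h5 hK hX9 hL
    hμ).mpr hbsdp

/-! ### §2. Suppliers of `hμ` and `hK` on X9: the `μ`-transfer node, and F1 -/

/-- **X9, per pair: the node `KatoMuTransfer` + one unit coefficient of `L_p(f, α)` ⟹ `μ(X(E/ℚ_∞)) = 0`
for every cyclotomic datum** (through the newform of `W` at level `N_E`, modularity `hmodP`).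
[cite: GreenbergLNM1716, §1 Conj. 1.11] [cite: Kato2004Asterisque, Thm. 12.6 (p. 222) and §17.13 (pp. 279–280)] -/
theorem X9.mu_eq_zero_of_katoMuTransfer_of_unitCoeff (hmodP : nonempty_modularParametrizationData)
    (hT : KatoMuTransfer) (hX9 : ClassX9 W p)
    (hcertA : ∀ {N : ℕ} [NeZero N] (f : CuspForm (Gamma0 N) 2), IsNewformOf W f →
      ∃ n : ℕ, ‖PowerSeries.coeff n (padicLFunction f (unitRoot W p : ℚ_[p]))‖ = 1) :
    ∀ (κ : ZpExtension ℚ p) (γ : Field.absoluteGaloisGroup ℚ),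
      κ.IsCyclotomic → κ.IsTopGenerator γ → IsCyclotomicVariable p γ →
      ∀ D : W.SelmerDualData κ γ, D.mu = 0 := by
  intro κ γ hκ hγ hγ' D
  obtain ⟨-, hp, hgood, hord, hirr, -⟩ := id hX9
  haveI : NeZero (W.conductorNorm ℤ) := ⟨(W.conductorNorm_pos_holds).ne'⟩
  obtain ⟨Dm⟩ := hmodP W
  exact hT W p Dm.f hp hgood hord hirr Dm.isNewformOf (hcertA Dm.f Dm.isNewformOf) κ γ hκ hγ hγ' D

/-- **X9, per pair: F1 + one unit coefficient of `L_p(f, α)` ⟹ `μ(X(E/ℚ_∞)) = 0` for every cyclotomic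
datum** — the X10 lane's UNCONDITIONAL kernel core at an odd good ordinary prime with irreducible
NON-surjective image (`X10.mu_eq_zero_of_fine`, GEN 40), read at an X9 pair (`p ≥ 5`).
[cite: Kato2004Asterisque, Thm. 12.5, Thm. 12.6 (p. 222), §13.8 and §17.13 (pp. 279–280)]
[cite: GreenbergVatsal2000, Prop. 3.7] -/
theorem X9.mu_eq_zero_of_fine_of_unitCoeff (hfine : exists_divisibilityInputs_fineQuotient_zeta)
    (hmodP : nonempty_modularParametrizationData) (hX9 : ClassX9 W p)
    (hcertA : ∀ {N : ℕ} [NeZero N] (f : CuspForm (Gamma0 N) 2), IsNewformOf W f →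
      ∃ n : ℕ, ‖PowerSeries.coeff n (padicLFunction f (unitRoot W p : ℚ_[p]))‖ = 1) :
    ∀ (κ : ZpExtension ℚ p) (γ : Field.absoluteGaloisGroup ℚ),
      κ.IsCyclotomic → κ.IsTopGenerator γ → IsCyclotomicVariable p γ →
      ∀ D : W.SelmerDualData κ γ, D.mu = 0 := by
  intro κ γ hκ hγ hγ' D
  obtain ⟨-, hp, hgood, hord, hirr, hns⟩ := id hX9
  haveI : NeZero (W.conductorNorm ℤ) := ⟨(W.conductorNorm_pos_holds).ne'⟩
  obtain ⟨Dm⟩ := hmodP W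
  exact Summit.BirchSwinnertonDyer.Rank1Residual.X10.mu_eq_zero_of_fine hfine W p Dm.f (by omega) hgood
    hord hirr hns Dm.isNewformOf (hcertA Dm.f Dm.isNewformOf) κ γ hκ hγ hγ' D

/-- **Kato's Thm. 17.4 at the pair, for the newforms of level `N_E` (the binder shape `hK` of §1), from
F1 alone** (`X10.kato_divisibility_of_fine`). [cite: Kato2004Asterisque, Thm. 17.4 (p. 273), Prop. 17.11 and §17.13 (pp. 279–280)] -/
theorem X9.kato_divisibility_of_fine (hfine : exists_divisibilityInputs_fineQuotient_zeta) :
    ∀ (κ : ZpExtension ℚ p) (γ : Field.absoluteGaloisGroup ℚ) [NeZero (W.conductorNorm ℤ)]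
      (f : CuspForm (Gamma0 (W.conductorNorm ℤ)) 2), kato_divisibility W p (κ := κ) (γ := γ) (f := f) :=
  fun κ γ _ f ↦ Summit.BirchSwinnertonDyer.Rank1Residual.X10.kato_divisibility_of_fine hfine W p κ γ
    (W.conductorNorm ℤ) f

/-! ### §3. Headline corollaries: the node form and the F1 form -/

/-- **X9 (analytic rank `≤ 1`), per pair, at a pair with `ord_p #Ш(E/ℚ)_an = 0`: the node
`KatoMuTransfer` ∧ Kato 17.4 (2) at the pair ∧ the finite certificates ⟹ Miller's `BSD(E,p)`.**
PUBLISHED `hGr`, `hS`, `hPR`, `hmodP`, `hmodL`, `hGZK`, `h5`, `hK`; CELL node `hT` (item 19629, kernel-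
checked modulo F1); certificates `hcertA`, `hunit`, `hSch` (rank 1 only). No BCS fact.
[cite: Kato2004Asterisque, Thm. 17.4 (2) (p. 273)] [cite: GreenbergLNM1716, §1 Conj. 1.11 and Thm. 4.1 (p. 102)]
[cite: PerrinRiou1987, §1.4 Cor. 1.8] [cite: Miller2011LMS, Def. 1.1 (arXiv:1010.2431 p. 3)] -/
theorem X9.bsdp_of_katoMuTransfer_of_unitCoeff_of_shaAn_unit (hGr : greenberg_charValue_rankZero)
    (hS : Schneider1985_order_charGenerator_odd) (hPR : perrinRiou_rankOne_leadingTerms_odd)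
    (hmodP : nonempty_modularParametrizationData) (hmodL : hasEntireLFunction_rat)
    (hGZK : rank_eq_analyticRank_of_analyticRank_le_one) (h5 : realPeriodRat_eq_unit_mul_plusPeriod)
    (hT : KatoMuTransfer)
    (hK : ∀ (κ : ZpExtension ℚ p) (γ : Field.absoluteGaloisGroup ℚ) [NeZero (W.conductorNorm ℤ)]
      (f : CuspForm (Gamma0 (W.conductorNorm ℤ)) 2), kato_divisibility W p (κ := κ) (γ := γ) (f := f))
    (hX9 : ClassX9 W p) (hr : W.analyticRank ≤ 1)
    (hSch : W.analyticRank = 1 → ∀ Dh : PAdicHeightData W p, Dh.IsCanonical → SchneiderConjecture Dh)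
    (hcertA : ∀ {N : ℕ} [NeZero N] (f : CuspForm (Gamma0 N) 2), IsNewformOf W f →
      ∃ n : ℕ, ‖PowerSeries.coeff n (padicLFunction f (unitRoot W p : ℚ_[p]))‖ = 1)
    (hunit : ∃ q : ℚ, shaAn W = (q : ℂ) ∧ padicValRat p q = 0) : BSDp W p :=
  X9.bsdp_of_kato_of_mu_eq_zero_of_shaAn_unit W p hGr hS hPR hmodP hmodL hGZK h5 hK hX9 hr hSch
    (X9.mu_eq_zero_of_katoMuTransfer_of_unitCoeff W p hmodP hT hX9 hcertA) hunit

/-- **X9 (analytic rank `≤ 1`), per pair, at a pair with `ord_p #Ш(E/ℚ)_an = 0`: F1 + PUBLISHED facts +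
finite certificates ⟹ Miller's `BSD(E,p)`.** Binders: F1 (`hfine`, Kato's zeta-element package — the
ONLY input not refereed in print as a theorem statement); PUBLISHED Greenberg Thm. 4.1 (`hGr`),
Perrin-Riou–Schneider / Perrin-Riou 1987 at odd `p` (`hS`, `hPR`; rank 1 only), modularity (`hmodP`,
`hmodL`), GZK (`hGZK`), the period unit (`h5`); certificates `hcertA` (unit coefficient), `hunit`
(`p ∤ #Ш_an`), `hSch` (rank 1). No BCS fact, no Heegner-index computation, no image hypothesis beyond X9.
[cite: Kato2004Asterisque, Thm. 12.5, 12.6 (p. 222), Thm. 17.4 (p. 273) and §17.13 (pp. 279–280)]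
[cite: GreenbergLNM1716, Thm. 4.1 (p. 102)] [cite: PerrinRiou1987, §1.4 Cor. 1.8]
[cite: Miller2011LMS, Def. 1.1 (arXiv:1010.2431 p. 3)] -/
theorem X9.bsdp_of_fine_of_unitCoeff_of_shaAn_unit (hfine : exists_divisibilityInputs_fineQuotient_zeta)
    (hGr : greenberg_charValue_rankZero)
    (hS : Schneider1985_order_charGenerator_odd) (hPR : perrinRiou_rankOne_leadingTerms_odd)
    (hmodP : nonempty_modularParametrizationData) (hmodL : hasEntireLFunction_rat)
    (hGZK : rank_eq_analyticRank_of_analyticRank_le_one) (h5 : realPeriodRat_eq_unit_mul_plusPeriod)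
    (hX9 : ClassX9 W p) (hr : W.analyticRank ≤ 1)
    (hSch : W.analyticRank = 1 → ∀ Dh : PAdicHeightData W p, Dh.IsCanonical → SchneiderConjecture Dh)
    (hcertA : ∀ {N : ℕ} [NeZero N] (f : CuspForm (Gamma0 N) 2), IsNewformOf W f →
      ∃ n : ℕ, ‖PowerSeries.coeff n (padicLFunction f (unitRoot W p : ℚ_[p]))‖ = 1)
    (hunit : ∃ q : ℚ, shaAn W = (q : ℂ) ∧ padicValRat p q = 0) : BSDp W p :=
  X9.bsdp_of_kato_of_mu_eq_zero_of_shaAn_unit W p hGr hS hPR hmodP hmodL hGZK h5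
    (X9.kato_divisibility_of_fine W p hfine) hX9 hr hSch
    (X9.mu_eq_zero_of_fine_of_unitCoeff W p hfine hmodP hX9 hcertA) hunit

/-- **X9 ∩ {r_an = 0}, per pair, at a pair with `ord_p #Ш(E/ℚ)_an = 0`: F1 + PUBLISHED facts +
certificates ⟹ Mazur's INTEGRAL cyclotomic main conjecture at the pair** (`MazurMainConjecture W p`:
`X` torsion, `char_Λ X = (g)`, `ι g = ϖ · L_p(f, α)` for every datum) — the integral equality of the
strategy sentence on the rank-0 `p ∤ #Ш_an` cells of X9, flag-free modulo F1.
[cite: Kato2004Asterisque, Thm. 12.5, 12.6 (p. 222), Thm. 17.4 (p. 273) and §17.13 (pp. 279–280)]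
[cite: GreenbergLNM1716, §1 Conj. 1.11, Thm. 4.1 and §5] -/
theorem X9.mazurMainConjecture_rankZero_of_fine_of_unitCoeff_of_shaAn_unit
    (hfine : exists_divisibilityInputs_fineQuotient_zeta) (hGr : greenberg_charValue_rankZero)
    (hmodP : nonempty_modularParametrizationData) (hmodL : hasEntireLFunction_rat)
    (hGZK : rank_eq_analyticRank_of_analyticRank_le_one) (h5 : realPeriodRat_eq_unit_mul_plusPeriod)
    (hX9 : ClassX9 W p) (hr0 : W.analyticRank = 0)
    (hcertA : ∀ {N : ℕ} [NeZero N] (f : CuspForm (Gamma0 N) 2), IsNewformOf W f →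
      ∃ n : ℕ, ‖PowerSeries.coeff n (padicLFunction f (unitRoot W p : ℚ_[p]))‖ = 1)
    (hunit : ∃ q : ℚ, shaAn W = (q : ℂ) ∧ padicValRat p q = 0) : MazurMainConjecture W p :=
  X9.mazurMainConjecture_rankZero_of_kato_of_mu_eq_zero_of_shaAn_unit W p hGr hmodP hmodL hGZK h5
    (X9.kato_divisibility_of_fine W p hfine) hX9 hr0
    (X9.mu_eq_zero_of_fine_of_unitCoeff W p hfine hmodP hX9 hcertA) hunit

end Summit.BirchSwinnertonDyer.BirchSwinnertonDyer.Rank1Residual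

end
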